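import Mathlib

/-!
# Hodge-locus census (pub-hlocus, ENGINE B gen 32) — anchor 9: the unique-factorisation step of THEOREM SPEC-3 / THEOREM E2″

certified instances and evidence bearing on the general Hodge conjecture; no claim.

In the proofs of THEOREM SPEC-3 (c) (record ENGINEB-g32.md §9f/§9h) and THEOREM E2″ (§10c, CASE A) the only
non-bookkeeping input is the following step in the polynomial ring `S` (a unique factorisation domain):
if `a₁, a₂` are non-associate primes (independent linear forms) and `ℓ₁ⱼ * a₂ = ℓ₂ⱼ * a₁`, then
`ℓ₁ⱼ = cⱼ a₁, ℓ₂ⱼ = cⱼ a₂` for a common `cⱼ` — STEP 3′ of the simplified proof (§9h) and LEMMA R1 of §10c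
(in the first write-up, §9f, the same shape appeared as STEP 2 with `q₁ a₂ = q₂ a₁ ⟹ qᵢ = aᵢ n`; the
theorem names below keep that historical numbering, the statements are the STEP 3′ / LEMMA R1 shape —
referee nit N-A9, R148).
We pin the ring-theoretic core of that step for an arbitrary commutative domain: a prime `a` with `¬ a ∣ b`
and `a * y = b * x` forces `x = a * c`, `y = b * c` for one and the same `c`.
-/

namespace Summit.HodgeConjecture.HodgeConjecture.HodgeLocus.Census.Spec3

/-- If `a` is prime, `a ∤ b` and `a * y = b * x`, then `a ∣ x`. -/
theorem dvd_of_prime_of_mul_eq {R : Type*} [CommRing R] {a b x y : R}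
    (ha : Prime a) (hab : ¬ a ∣ b) (h : a * y = b * x) : a ∣ x := by
  have hdvd : a ∣ b * x := ⟨y, by rw [← h]⟩
  rcases ha.dvd_or_dvd hdvd with hb | hx
  · exact absurd hb hab
  · exact hx

/-- The rank-one conclusion used in STEP 3′ (§9h) / LEMMA R1 (§10c): in a domain, a prime `a` with
`a ∤ b` and `a * y = b * x` gives a COMMON cofactor `c` with `x = a * c` and `y = b * c`. -/
theorem exists_common_cofactor {R : Type*} [CommRing R] [IsDomain R] {a b x y : R}
    (ha : Prime a) (hab : ¬ a ∣ b) (h : a * y = b * x) :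
    ∃ c : R, x = a * c ∧ y = b * c := by
  obtain ⟨c, hc⟩ := dvd_of_prime_of_mul_eq ha hab h
  refine ⟨c, hc, ?_⟩
  have ha0 : a ≠ 0 := ha.ne_zero
  have : a * y = a * (b * c) := by rw [h, hc]; ring
  exact mul_left_cancel₀ ha0 this

/-- The shape actually invoked in STEP 3′ (§9h) and LEMMA R1 (§10c) — only `a₁` prime and `a₁ ∤ a₂` are
needed: `q₁ a₂ = q₂ a₁ ⟹ q₁ = a₁ n, q₂ = a₂ n` for one `n` (applied with `qᵢ = ℓᵢⱼ`, `n = cⱼ`).  The name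
`step2_shape` is the historical §9f numbering (referee nit N-A9: the statement is the STEP 3′ / LEMMA R1 shape). -/
theorem step2_shape {R : Type*} [CommRing R] [IsDomain R] {a₁ a₂ q₁ q₂ : R}
    (h₁ : Prime a₁) (h₁₂ : ¬ a₁ ∣ a₂) (h : q₁ * a₂ = q₂ * a₁) :
    ∃ n : R, q₁ = a₁ * n ∧ q₂ = a₂ * n := by
  have h' : a₁ * q₂ = a₂ * q₁ := by
    have := h.symm
    -- q₂ * a₁ = q₁ * a₂
    calc a₁ * q₂ = q₂ * a₁ := by ring
      _ = q₁ * a₂ := this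
      _ = a₂ * q₁ := by ring
  obtain ⟨n, hq₁, hq₂⟩ := exists_common_cofactor h₁ h₁₂ h'
  exact ⟨n, hq₁, hq₂⟩

end Summit.HodgeConjecture.HodgeConjecture.HodgeLocus.Census.Spec3
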